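import Summits.AtomisticToContinuum.Crystallization.Theorems.OverbindingBudgetRecurrentSeal
import Summits.AtomisticToContinuum.Crystallization.Theorems.OverbindingBudgetRecurrentDustClosureTwo
import Summits.AtomisticToContinuum.Crystallization.Theorems.OverbindingBudgetRecurrentDustClosureThree
import Summits.AtomisticToContinuum.Crystallization.Theorems.OverbindingBudgetMinimalCone

/-!
# OverbindingBudget — laws 5 (`DustLaw`) and 3 (`DislocationLaw`) REDUCED TO THEIR EXTREMAL CLASS; the minimal cone on recurrent textures
(helper, `--supports stmt-AtomisticToContinuum-31280`; decomp-a2c lens 4 «minimal counterexample / extremal reduction», generation 22; node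
«RecurrentDust»)

Route `OverbindingBudget` (Crystallization), crux `RobustDefectLimitWindows` (stmt-AtomisticToContinuum-31280), registered line v7 «HostedDustCut»
(sha 624a0fa0…), minimal cone of generation 20 (`…MinimalCone.rdef_of_laws_coherent`: the crux follows from `DislocationLaw` (stub 3),
`SealedChargeLaw 24 48 10` (stub 4), `DustLaw` (stub 5), `CleanlessExcessT`, `CoherentResidual 10`).  Generation 21 normalised law 4 to its
extremal class (`…RecurrentSeal.sealedChargeLaw_numerals_of_recurrent : RecurrentSealedChargeLaw 24 48 → SealedChargeLaw 24 48 10`).  Nothing is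
registered, re-cut or re-typed here (waivers (w2)/(w3); critic row 279: «laws 3/5 normalisation by the same hull argument = admissible next node»).
This file proves, complete and over landed Theorems files only, the same NORMAL-FORM THEOREMS for the two remaining open laws of the cone —

**`dustLaw_of_recurrentDustLaw : RecurrentDustLaw → DustLaw`**, **`dislocationLaw_of_recurrentDislocationLaw : RecurrentDislocationLaw →
DislocationLaw`** (BY NAME, the `…MinimalCone` constants = the registered texts of `stub_dustChargeLaw` / `stub_dislocationDensityLaw`, pins
`dustLaw_iff` / `dislocationLaw_iff`), and the cone corollary **`rdef_of_recurrent_laws : RecurrentDislocationLaw → RecurrentSealedChargeLaw 24 48 →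
RecurrentDustLaw → CleanlessExcessT → CoherentResidual 10 → RobustDefectLimitWindows`**: ALL THREE open laws of the minimal cone may be proved on
ONE extremal class — uniformly discrete, ROOTED (`0 ∈ Y`), UNIFORMLY RECURRENT (`UniformlyRecurrent`: every `R`-patch recurs with bounded gaps up to
`ε`, two-way local matchings `Match` of `MuGSC`), `9/10`-covering textures — with the Barlow-matrix hypothesis `MAT` DROPPED.

`RecurrentDustLaw` (…RecurrentDustStatements §K): law 5 on that class, with thin cores LOOSENED (`ThinCoresL a 10`: within 10 of every point a
site that is `CleanT a (-s)` at every loosening `s ∈ (0, 1/100)`; an exactly clean Barlow-close site is one), Burgers-freeness VERBATIM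
(`BurgersFree`), unsealedness LOOSENED (`UnsealedL a 24 48`: clean pairs closer than 24 linked through loosened-clean sites at every loosening
`t' ∈ (t, a/50]` instead of at `-t` exactly), violators VERBATIM (`¬ RT a t`, `L`-dense).  `RecurrentDislocationLaw`: law 3 on that class, with
`ThinCoresL a 10` and the Burgers clause VERBATIM (`L`-dense undevelopable `t`-robustly clean sets of `≤ M` sites).

PROOF (the lens, applied to the laws' would-be counterexamples; template = generation 21).  Were a texture `Y` with the hypotheses of law 5
FLAT (site charge `≤ η ℓ³` on all cubes of side `≥ m η`, every `η > 0`: `FlatMod`), the HULL FAMILY `HullDust` of rooted, `δ`-separated,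
`9/10`-covering textures with `ThinCoresL a 10`, `BurgersFree a`, `UnsealedL a 24 48`, robust violators at every margin below `t` `L`-densely
(`ViolatorsL a t L`) and `FlatMod e m` contains `Y − y₀` (§L margins + §M translation covariance), is re-rooting closed (§M) and closed under
local limits: `solid_of_limit`, `flatMod_of_limit` (generation 21); `thinCoresL_of_limit`, `violatorsL_of_limit` (…RecurrentDustClosure:
pigeonhole the partner site in the limit along `ε → 0⁺`; loosened cleanness is transported INTO a fixed limit site at every loosening by
`cleanT_transport₂` under its SLIVER CONDITION — no limit site at distance in `(1.02a, 1.02a + 2ε]`, true for all small `ε` by finiteness of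
balls; the relaxed test `RT` crosses a matching with margin loss `3ε`, `rt_of_match`); `burgersFree_of_limit`, `burgersDenseL_of_limit`
(…ClosureTwo: developability is a CONTACT-GRAPH property and `t`-clean pair distances avoid `(1.02a - t, 1.26a + t)`, so partner maps are
contact-graph isomorphisms); `unsealedL_of_limit` (…ClosureThree: carry the contact path node by node into the limit at loosening `-t'` from
loosening `-(t' - 3ε)` in a good approximant).  The HULL ENGINE `minimalRecurrent` (generation 21, Zorn + Birkhoff over `Match`) yields a
UNIFORMLY RECURRENT member `Z`; the recurrent law at margin `t/2` charges `Z` — contradicting its flatness.  Law 3: the same with `HullBurgers`.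

PIECES / TAGS (decomp-a2c bookkeeping; card NODE-g22-RecurrentDust.md).  `DustLaw` ⟸ [T5] ∧ [RDL], `DislocationLaw` ⟸ [T3] ∧ [RBL]:
[T5], [T3] = this file's reductions, PROVED (0 sorry);  [RDL] = `RecurrentDustLaw`, [RBL] = `RecurrentDislocationLaw`: XL · IDEA-NEEDED ·
INSTRUMENTABLE (I-RDU: cheapest PERIODIC textures of covering radius `≤ 9/10` carrying, per period box, (a) a `t`-robust violator of the
gapped-twelve test in a Burgers-free unsealed Barlow matrix, resp. (b) an undevelopable `t`-clean circuit — finite-dimensional variational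
problems; a flat periodic dust / dislocation texture refutes the recurrent law AND the registered law alike) · STRONGER-in-kind than the
registered stubs on the `MAT` / loosened-thin-cores / loosened-unsealedness / `≤ 9/10` axes, WEAKER on the rooted + uniformly-recurrent axis
(defect DENSITY per unit volume — the quantity every pricing argument for laws 3/5 is multiplied against — is free on the recurrent class:
every patch recurs syndetically).  No piece is COSTUME: [RDL]/[RBL] do not mention the laws' general textures; the probes `[RDL] → DustLaw`-free
directions (`DustLaw → [RDL]`, `[RDL] → Crystallization`, `[RDL] → RobustDefectLimitWindows`) fail (bc/probes22.lean).  With generation 21: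
`RobustDefectLimitWindows` ⟸ [RBL] ∧ [RSE] ∧ [RDL] ∧ `CleanlessExcessT` ∧ `CoherentResidual 10` (`rdef_of_recurrent_laws`).

FILES OF THE NODE (five, by the 400-line rule; all `--supports stmt-AtomisticToContinuum-31280 --as helper`): `…RecurrentDustStatements` (§K–§M),
`…RecurrentDustClosure` (§N–§O), `…RecurrentDustClosureTwo` (§P–§Q), `…RecurrentDustClosureThree` (§R), THIS FILE (§S readable pins, §T the two
reductions, §U the cone corollary).
-/

noncomputable section

namespace Summit.AtomisticToContinuum.Crystallization.Theorems.OverbindingBudgetRecurrentDust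

open Filter Metric Set Topology
open Literature.MathematicalPhysics.StatisticalMechanics
open Literature.Geometry.DiscreteGeometry (ShellCloseTo fccKissingPattern hcpKissingPattern)
open Summit.AtomisticToContinuum.Crystallization.Theses.OverbindingBudget (RobustDefectLimitWindows)
open Summit.AtomisticToContinuum.Crystallization.Theorems.OverbindingBudgetWallTensionLever (CleanT TouchT Linked MAT ThinCores BarlowClose
  SealedChargeLaw)
open Summit.AtomisticToContinuum.Crystallization.Theorems.OverbindingBudgetViolatorDensityFloor (GT RT)
open Summit.AtomisticToContinuum.Crystallization.Theorems.OverbindingBudgetGradedBareness (cleanT_anti CleanlessExcessT)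
open Summit.AtomisticToContinuum.Crystallization.Theorems.OverbindingBudgetCleanlessCut (margin_le_of_cleanT)
open Summit.AtomisticToContinuum.Crystallization.Theorems.OverbindingBudgetCoherentCut (CoherentResidual)
open Summit.AtomisticToContinuum.Crystallization.Theorems.OverbindingBudgetMinimalCone (DustLaw DislocationLaw rdef_of_laws_coherent)
open Summit.AtomisticToContinuum.Crystallization.Theorems.OverbindingBudgetHullEngine (minimalRecurrent)
open Summit.AtomisticToContinuum.Crystallization.Theorems.OverbindingBudgetRecurrentSealStatements
open Summit.AtomisticToContinuum.Crystallization.Theorems.OverbindingBudgetRecurrentSealClosure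
open Summit.AtomisticToContinuum.Crystallization.Theorems.OverbindingBudgetRecurrentSeal (flatMod_of_limit sealedChargeLaw_numerals_of_recurrent)
open Summit.AtomisticToContinuum.Crystallization.Theorems.OverbindingBudgetRecurrentDustStatements
open Summit.AtomisticToContinuum.Crystallization.Theorems.OverbindingBudgetRecurrentDustClosure
open Summit.AtomisticToContinuum.Crystallization.Theorems.OverbindingBudgetRecurrentDustClosureTwo
open Summit.AtomisticToContinuum.Crystallization.Theorems.OverbindingBudgetRecurrentDustClosureThree

/-! ## §S  Readable pins of the registered texts of laws 5 and 3 -/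

/-- `DustLaw` (the registered text of stub 5) read through the lineage's predicates, `Iff.rfl`. -/
theorem dustLaw_iff_readable : DustLaw ↔
    (∀ e : ℝ, Filter.Tendsto (fun N : ℕ => groundStateEnergy lennardJones 3 N / N) Filter.atTop (nhds e) →
      (∀ N : ℕ, 0 < N → e ≤ groundStateEnergy lennardJones 3 N / N) →
      ∀ Y : Set (EuclideanSpace ℝ (Fin 3)), UniformlyDiscrete Y → (∀ z : (EuclideanSpace ℝ (Fin 3)), ∃ w ∈ Y, dist z w < 9 / 10) →
      ∀ a : ℝ, 47 / 50 ≤ a → a ≤ 1 → ∀ t : ℝ, 0 < t → ∀ L : ℝ, MAT a Y → ThinCores a 10 Y → BurgersFree a Y →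
      (∀ t : ℝ, 0 < t → ∀ y ∈ Y, ∀ y' ∈ Y, CleanT a t Y y → CleanT a t Y y' → dist y y' ≤ 24 → Linked a (-t) 48 Y y y') →
      (∀ q ∈ Y, ∃ y ∈ Y, dist y q ≤ L ∧ ¬ RT a t Y y) →
      ∃ η : ℝ, 0 < η ∧ ∀ ℓ₀ : ℝ, ∃ ℓ : ℝ, ∃ c : (EuclideanSpace ℝ (Fin 3)), ∃ F : Finset (EuclideanSpace ℝ (Fin 3)), ℓ₀ ≤ ℓ ∧
        (↑F : Set (EuclideanSpace ℝ (Fin 3))) = Y ∩ {z | ∀ i : Fin 3, c i ≤ z i ∧ z i < c i + ℓ} ∧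
        η * ℓ ^ 3 < ∑ y ∈ F, ((∑' w : ↥Y, lennardJones (dist y (w : (EuclideanSpace ℝ (Fin 3))))) - 2 * e)) :=
  Iff.rfl

/-- `DislocationLaw` (the registered text of stub 3) read through the lineage's predicates, `Iff.rfl`. -/
theorem dislocationLaw_iff_readable : DislocationLaw ↔
    (∀ e : ℝ, Filter.Tendsto (fun N : ℕ => groundStateEnergy lennardJones 3 N / N) Filter.atTop (nhds e) →
      (∀ N : ℕ, 0 < N → e ≤ groundStateEnergy lennardJones 3 N / N) →
      ∀ Y : Set (EuclideanSpace ℝ (Fin 3)), UniformlyDiscrete Y → (∀ z : (EuclideanSpace ℝ (Fin 3)), ∃ w ∈ Y, dist z w < 9 / 10) →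
      ∀ a : ℝ, 47 / 50 ≤ a → a ≤ 1 → ∀ t : ℝ, 0 < t → MAT a Y → ThinCores a 10 Y →
      (∃ L M : ℝ, ∀ p ∈ Y, ∃ S : Finset (EuclideanSpace ℝ (Fin 3)), (↑S : Set (EuclideanSpace ℝ (Fin 3))) ⊆ Y ∧ (S.card : ℝ) ≤ M ∧
        (∀ y ∈ S, dist y p ≤ L) ∧ (∀ y ∈ S, CleanT a t Y y) ∧ ¬ Developable a S) →
      ∃ η : ℝ, 0 < η ∧ ∀ ℓ₀ : ℝ, ∃ ℓ : ℝ, ∃ c : (EuclideanSpace ℝ (Fin 3)), ∃ F : Finset (EuclideanSpace ℝ (Fin 3)), ℓ₀ ≤ ℓ ∧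
        (↑F : Set (EuclideanSpace ℝ (Fin 3))) = Y ∩ {z | ∀ i : Fin 3, c i ≤ z i ∧ z i < c i + ℓ} ∧
        η * ℓ ^ 3 < ∑ y ∈ F, ((∑' w : ↥Y, lennardJones (dist y (w : (EuclideanSpace ℝ (Fin 3))))) - 2 * e)) :=
  Iff.rfl

/-! ## §T  The two reductions -/

/-- **Law 5 reduces to its recurrent class.**  `RecurrentDustLaw → DustLaw`: the Barlow-matrix hypothesis is not needed, thin cores and
unsealedness may be loosened, and the texture may be assumed rooted and UNIFORMLY RECURRENT (proof in the module docstring). -/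
theorem dustLaw_of_recurrentDustLaw (h : RecurrentDustLaw) : DustLaw := by
  classical
  rw [dustLaw_iff_readable]
  intro e hT hLB Y hUD hcov a ha ha1 t ht L _hMAT hThin' hBF hUNS' hVD'
  by_contra hnot
  -- flatness modulus of `Y`
  have hflat : ∀ η : ℝ, ∃ ℓ₀ : ℝ, 0 < η → ∀ ℓ : ℝ, ∀ c : (EuclideanSpace ℝ (Fin 3)), ∀ F : Finset (EuclideanSpace ℝ (Fin 3)), ℓ₀ ≤ ℓ →
      (↑F : Set (EuclideanSpace ℝ (Fin 3))) = Y ∩ {z | ∀ i : Fin 3, c i ≤ z i ∧ z i < c i + ℓ} →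
      ∑ y ∈ F, ((∑' w : ↥Y, lennardJones (dist y (w : (EuclideanSpace ℝ (Fin 3))))) - 2 * e) ≤ η * ℓ ^ 3 := by
    intro η
    by_cases hη : 0 < η
    · by_contra hcon
      push Not at hcon
      exact hnot ⟨η, hη, fun ℓ₀ => (hcon ℓ₀).2⟩
    · exact ⟨0, fun h' => absurd h' hη⟩
  choose m hm using hflat
  have hFlatY : FlatMod e m Y := fun η hη ℓ c F hℓ hF => hm η hη ℓ c F hℓ hF
  have hUD' := hUD
  obtain ⟨δ, hδ, hsepY⟩ := hUD
  have ha0 : 0 < a := by linarith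
  -- the limit-stable forms of the hypotheses
  have hThin : ThinCoresL a 10 Y := thinCoresL_of_thinCores ha hThin'
  have hUNS : UnsealedL a 24 48 Y := unsealedL_of_unsealed hUNS'
  have hVD : ViolatorsL a t L Y := violatorsL_of_violators hUD' hVD'
  have hSolidY : ∀ z : (EuclideanSpace ℝ (Fin 3)), ∃ w ∈ Y, dist z w ≤ 9 / 10 := fun z =>
    let ⟨w, hw, hd⟩ := hcov z
    ⟨w, hw, hd.le⟩
  -- the hull family
  obtain ⟨y₀, hy₀, -⟩ := hcov 0
  have hne : (HullDust δ a t L e m).Nonempty :=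
    ⟨(fun p => p - y₀) '' Y, mem_hullDust.2 ⟨⟨y₀, hy₀, sub_self y₀⟩, sep_translate y₀ hsepY, solid_translate y₀ hSolidY,
      thinCoresL_translate y₀ hThin, burgersFree_translate y₀ hBF, unsealedL_translate y₀ hUNS, violatorsL_translate y₀ hVD,
      flatMod_translate y₀ hFlatY⟩⟩
  have hsepC : ∀ Z ∈ HullDust δ a t L e m, ∀ p ∈ Z, ∀ q ∈ Z, p ≠ q → δ ≤ dist p q := fun Z hZ => (mem_hullDust.1 hZ).2.1
  have h0C : ∀ Z ∈ HullDust δ a t L e m, (0 : (EuclideanSpace ℝ (Fin 3))) ∈ Z := fun Z hZ => (mem_hullDust.1 hZ).1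
  have hrootC : ∀ Z ∈ HullDust δ a t L e m, ∀ z ∈ Z, (fun p => p - z) '' Z ∈ HullDust δ a t L e m := by
    intro Z hZ z hz
    obtain ⟨-, h2, h3, h4, h5, h6, h7, h8⟩ := mem_hullDust.1 hZ
    exact mem_hullDust.2 ⟨⟨z, hz, sub_self z⟩, sep_translate z h2, solid_translate z h3, thinCoresL_translate z h4,
      burgersFree_translate z h5, unsealedL_translate z h6, violatorsL_translate z h7, flatMod_translate z h8⟩
  have hclosedC : ∀ Zs : ℕ → Set (EuclideanSpace ℝ (Fin 3)), (∀ k, Zs k ∈ HullDust δ a t L e m) → ∀ Z : Set (EuclideanSpace ℝ (Fin 3)),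
      (0 : (EuclideanSpace ℝ (Fin 3))) ∈ Z → (∀ p ∈ Z, ∀ q ∈ Z, p ≠ q → δ ≤ dist p q) →
      (∀ R ε : ℝ, 0 < ε → ∀ᶠ k in atTop, Match ε R 0 (Zs k) Z) → Z ∈ HullDust δ a t L e m := by
    intro Zs hZs Z hZ0 hZsep hconv
    have hk := fun k => mem_hullDust.1 (hZs k)
    exact mem_hullDust.2 ⟨hZ0, hZsep, solid_of_limit hδ hZsep hconv fun k => (hk k).2.2.1,
      thinCoresL_of_limit hδ ha ha1 (fun k => (hk k).2.1) hZsep hconv fun k => (hk k).2.2.2.1,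
      burgersFree_of_limit hδ ha ha1 (fun k => (hk k).2.1) hZsep hconv fun k => (hk k).2.2.2.2.1,
      unsealedL_of_limit hδ ha ha1 (fun k => (hk k).2.1) hZsep hconv fun k => (hk k).2.2.2.2.2.1,
      violatorsL_of_limit hδ ha ha1 (fun k => (hk k).2.1) hZsep hconv fun k => (hk k).2.2.2.2.2.2.1,
      flatMod_of_limit hδ (fun k => (hk k).2.1) hZsep hconv fun k => (hk k).2.2.2.2.2.2.2⟩
  obtain ⟨Z, hZC, hrec⟩ := minimalRecurrent δ hδ _ hne hsepC h0C hrootC hclosedC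
  obtain ⟨hZ0, hZsep, hZsolid, hZT, hZB, hZU, hZV, hZflat⟩ := mem_hullDust.1 hZC
  -- the recurrent law at margin `t/2` charges `Z`, contradicting its flatness
  have hV2 : ∀ q ∈ Z, ∃ y ∈ Z, dist y q ≤ L ∧ ¬ RT a (t / 2) Z y := fun q hq =>
    let ⟨y, hy, hd, hn⟩ := hZV q hq
    ⟨y, hy, hd, hn (t / 2) (by linarith) (by linarith)⟩
  obtain ⟨η, hη, hcubes⟩ := h e hT hLB Z ⟨δ, hδ, hZsep⟩ hZ0 hrec hZsolid a ha ha1 (t / 2) (by linarith) L hZT hZB hZU hV2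
  obtain ⟨ℓ, c, F, hℓ, hF, hlt⟩ := hcubes (m η)
  have := hZflat η hη ℓ c F hℓ hF
  linarith

/-- **Law 3 reduces to its recurrent class.**  `RecurrentDislocationLaw → DislocationLaw`: the Barlow-matrix hypothesis is not needed, thin
cores may be loosened, and the texture may be assumed rooted and UNIFORMLY RECURRENT. -/
theorem dislocationLaw_of_recurrentDislocationLaw (h : RecurrentDislocationLaw) : DislocationLaw := by
  classical
  rw [dislocationLaw_iff_readable]
  intro e hT hLB Y hUD hcov a ha ha1 t ht _hMAT hThin' hBD'
  by_contra hnot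
  have hflat : ∀ η : ℝ, ∃ ℓ₀ : ℝ, 0 < η → ∀ ℓ : ℝ, ∀ c : (EuclideanSpace ℝ (Fin 3)), ∀ F : Finset (EuclideanSpace ℝ (Fin 3)), ℓ₀ ≤ ℓ →
      (↑F : Set (EuclideanSpace ℝ (Fin 3))) = Y ∩ {z | ∀ i : Fin 3, c i ≤ z i ∧ z i < c i + ℓ} →
      ∑ y ∈ F, ((∑' w : ↥Y, lennardJones (dist y (w : (EuclideanSpace ℝ (Fin 3))))) - 2 * e) ≤ η * ℓ ^ 3 := by
    intro η
    by_cases hη : 0 < η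
    · by_contra hcon
      push Not at hcon
      exact hnot ⟨η, hη, fun ℓ₀ => (hcon ℓ₀).2⟩
    · exact ⟨0, fun h' => absurd h' hη⟩
  choose m hm using hflat
  have hFlatY : FlatMod e m Y := fun η hη ℓ c F hℓ hF => hm η hη ℓ c F hℓ hF
  obtain ⟨δ, hδ, hsepY⟩ := hUD
  have ha0 : 0 < a := by linarith
  obtain ⟨L, M, hLM⟩ := hBD'
  have hThin : ThinCoresL a 10 Y := thinCoresL_of_thinCores ha hThin'
  have hBD : BurgersDenseL a t L M Y := burgersDenseL_of_dense ha hLM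
  have hSolidY : ∀ z : (EuclideanSpace ℝ (Fin 3)), ∃ w ∈ Y, dist z w ≤ 9 / 10 := fun z =>
    let ⟨w, hw, hd⟩ := hcov z
    ⟨w, hw, hd.le⟩
  obtain ⟨y₀, hy₀, -⟩ := hcov 0
  have hne : (HullBurgers δ a t L M e m).Nonempty :=
    ⟨(fun p => p - y₀) '' Y, mem_hullBurgers.2 ⟨⟨y₀, hy₀, sub_self y₀⟩, sep_translate y₀ hsepY, solid_translate y₀ hSolidY,
      thinCoresL_translate y₀ hThin, burgersDenseL_translate y₀ hBD, flatMod_translate y₀ hFlatY⟩⟩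
  have hsepC : ∀ Z ∈ HullBurgers δ a t L M e m, ∀ p ∈ Z, ∀ q ∈ Z, p ≠ q → δ ≤ dist p q :=
    fun Z hZ => (mem_hullBurgers.1 hZ).2.1
  have h0C : ∀ Z ∈ HullBurgers δ a t L M e m, (0 : (EuclideanSpace ℝ (Fin 3))) ∈ Z := fun Z hZ => (mem_hullBurgers.1 hZ).1
  have hrootC : ∀ Z ∈ HullBurgers δ a t L M e m, ∀ z ∈ Z, (fun p => p - z) '' Z ∈ HullBurgers δ a t L M e m := by
    intro Z hZ z hz
    obtain ⟨-, h2, h3, h4, h5, h6⟩ := mem_hullBurgers.1 hZ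
    exact mem_hullBurgers.2 ⟨⟨z, hz, sub_self z⟩, sep_translate z h2, solid_translate z h3, thinCoresL_translate z h4,
      burgersDenseL_translate z h5, flatMod_translate z h6⟩
  have hclosedC : ∀ Zs : ℕ → Set (EuclideanSpace ℝ (Fin 3)), (∀ k, Zs k ∈ HullBurgers δ a t L M e m) →
      ∀ Z : Set (EuclideanSpace ℝ (Fin 3)), (0 : (EuclideanSpace ℝ (Fin 3))) ∈ Z → (∀ p ∈ Z, ∀ q ∈ Z, p ≠ q → δ ≤ dist p q) →
      (∀ R ε : ℝ, 0 < ε → ∀ᶠ k in atTop, Match ε R 0 (Zs k) Z) → Z ∈ HullBurgers δ a t L M e m := by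
    intro Zs hZs Z hZ0 hZsep hconv
    have hk := fun k => mem_hullBurgers.1 (hZs k)
    exact mem_hullBurgers.2 ⟨hZ0, hZsep, solid_of_limit hδ hZsep hconv fun k => (hk k).2.2.1,
      thinCoresL_of_limit hδ ha ha1 (fun k => (hk k).2.1) hZsep hconv fun k => (hk k).2.2.2.1,
      burgersDenseL_of_limit hδ ha ha1 ht (fun k => (hk k).2.1) hZsep hconv fun k => (hk k).2.2.2.2.1,
      flatMod_of_limit hδ (fun k => (hk k).2.1) hZsep hconv fun k => (hk k).2.2.2.2.2⟩
  obtain ⟨Z, hZC, hrec⟩ := minimalRecurrent δ hδ _ hne hsepC h0C hrootC hclosedC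
  obtain ⟨hZ0, hZsep, hZsolid, hZT, hZBD, hZflat⟩ := mem_hullBurgers.1 hZC
  have hBD2 : ∃ L M : ℝ, ∀ p ∈ Z, ∃ S : Finset (EuclideanSpace ℝ (Fin 3)), (↑S : Set (EuclideanSpace ℝ (Fin 3))) ⊆ Z ∧ (S.card : ℝ) ≤ M ∧
      (∀ y ∈ S, dist y p ≤ L) ∧ (∀ y ∈ S, CleanT a (t / 2) Z y) ∧ ¬ Developable a S := by
    refine ⟨L, M, fun p hp => ?_⟩
    obtain ⟨S, h1, h2, h3, h4, h5⟩ := hZBD p hp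
    exact ⟨S, h1, h2, h3, fun y hy => h4 (t / 2) (by linarith) (by linarith) y hy, h5⟩
  obtain ⟨η, hη, hcubes⟩ := h e hT hLB Z ⟨δ, hδ, hZsep⟩ hZ0 hrec hZsolid a ha ha1 (t / 2) (by linarith) hZT hBD2
  obtain ⟨ℓ, c, F, hℓ, hF, hlt⟩ := hcubes (m η)
  have := hZflat η hη ℓ c F hℓ hF
  linarith

/-! ## §U  The minimal cone on the recurrent class -/

/-- **The crux from the three recurrent laws.**  With generation 20's cone `rdef_of_laws_coherent` and generation 21's law-4 reduction:
`RobustDefectLimitWindows` follows from `RecurrentDislocationLaw`, `RecurrentSealedChargeLaw 24 48`, `RecurrentDustLaw`, `CleanlessExcessT` and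
`CoherentResidual 10` — every open law of the minimal cone is now posed on rooted, uniformly recurrent textures. -/
theorem rdef_of_recurrent_laws (h3 : RecurrentDislocationLaw) (h4 : RecurrentSealedChargeLaw 24 48) (h5 : RecurrentDustLaw)
    (hCE : CleanlessExcessT) (hR : CoherentResidual 10) : RobustDefectLimitWindows :=
  rdef_of_laws_coherent (dislocationLaw_of_recurrentDislocationLaw h3) (sealedChargeLaw_numerals_of_recurrent h4)
    (dustLaw_of_recurrentDustLaw h5) hCE hR

/-- Stub 5 of the registered line, BY ITS `…MinimalCone` NAME, from the recurrent law (pin). -/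
theorem stub5_of_recurrent (h5 : RecurrentDustLaw) : Summit.AtomisticToContinuum.Crystallization.Theorems.OverbindingBudgetMinimalCone.DustLaw :=
  dustLaw_of_recurrentDustLaw h5

/-- Stub 3 of the registered line, BY ITS `…MinimalCone` NAME, from the recurrent law (pin). -/
theorem stub3_of_recurrent (h3 : RecurrentDislocationLaw) :
    Summit.AtomisticToContinuum.Crystallization.Theorems.OverbindingBudgetMinimalCone.DislocationLaw :=
  dislocationLaw_of_recurrentDislocationLaw h3

end Summit.AtomisticToContinuum.Crystallization.Theorems.OverbindingBudgetRecurrentDust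

end
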